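import Literature.RepresentationTheory.MoeglinVignerasWaldspurger1987.MetaplecticDirectSum
import Literature.RepresentationTheory.HarrisKudlaSweet1996.Splittings
import HarnessLib

/-!
# The Weil representation of a unitary dual pair as a pullback along splittings, and its multiplicativity in an
# orthogonal sum `W = W₁ ⊕ W₂` (the seesaw restriction) — definitions after Gan–Takeda §2.8 / HKS §1, with the
# restriction identity PROVED from MVW Rem. (6), HKS Cor. A.3 and the partner-side compatibility

AS PRINTED, W. T. Gan, S. Takeda, *A proof of the Howe duality conjecture*, J. Amer. Math. Soc. 29 (2016)
[GanTakeda2015], §2.8 "Weil representations" (held arXiv TeX arXiv:1407.1995, chunk p0005 L170, p0006 L1–11): "To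
consider the Weil representation of the pair `G(W) × H(V)`, we need to specify extra data to give a splitting
`G(W) × H(V) → Mp(W ⊗ V)` of the dual pair.  Such splittings were constructed and parametrized by Kudla [k94] and we
shall use his convention here, as described in [gi].  In particular, a splitting is specified by fixing a pair of
splitting characters `χ = (χ_V, χ_W)`, which are certain unitary characters of `E^×`.  Pulling back the Weil
representation of `Mp(W ⊗ V)` to `G(W) × H(V)` via the splitting, we obtain the associated Weil representation
`ω_{W,V,χ,ψ}` of `G(W) × H(V)`."  ([k94] = [Kudla1994]; the splittings and their compatibility with
`G(W₁) × G(W₂) ⊂ G(W)` are [HarrisKudlaSweet1996, (1.14)–(1.19), Cor. A.3] —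
`Literature/RepresentationTheory/HarrisKudlaSweet1996/Splittings.lean`; the tensor decomposition of `ω_ψ` along
Kudla's `j̃ : Mp(𝕎₁) × Mp(𝕎₂) → Mp(𝕎)` is [MoeglinVignerasWaldspurger1987, Chap. 2 II.1 Rem. (6)] —
`…/MoeglinVignerasWaldspurger1987/MetaplecticDirectSum.lean`.)

WHAT IS HERE.  Over ONE hypothesis structure `UnitarySeesawCover` of bare carriers for an orthogonal sum
`W = W₁ ⊕ W₂` of skew-Hermitian spaces paired with one Hermitian space `V` (parameter types for `G(W₁)`, `G(W₂)`,
`G(W)`, `H(V)`, the three metaplectic groups and the three spaces of `ω_ψ`; fields: the inclusion, `j̃`, the three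
`ω_ψ`, the `G`-side splittings `ι̃_{V,χ_V}` and the `H`-side splittings `ι̃_{W,χ_W}`, `ι̃_{W₁,χ₁}`, `ι̃_{W₂,χ₂}`):
(1) the DEFINITION of the three Weil representations of the unitary pairs as PULLBACKS (`omega`, `omega₁`, `omega₂`)
— Gan–Takeda's sentence; (2) the two compatibility predicates one needs (`HSideCompatible`: `j̃(ι̃_{W₁,χ₁}(h),
ι̃_{W₂,χ₂}(h)) = ι̃_{W,χ_W}(h)` — the partner-side counterpart of Cor. A.3, which in the coordinates (1.12) is the
product rule `β_{W₁,χ₁} β_{W₂,χ₂} = β_{W₁⊕W₂,χ₁χ₂}` of `HKSSplittingDatum.beta_sum` together with Ranga Rao's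
Prop. 3.7; and `SplittingsCompatible` on `G(W₁) × G(W₂) × H(V)`), nothing asserted; (3) PROVED: Cor. A.3 +
`HSideCompatible` ⇒ `SplittingsCompatible` (`splittingsCompatible_of`, `j̃` being a homomorphism), and THE SEESAW
RESTRICTION: if `ω_ψ ∘ j̃ ≃ ω_ψ^1 ⊠ ω_ψ^2` via `e` (MVW Rem. (6)) and the splittings are compatible, then
`e (ω_{W₁,V}(g₁,h)x₁ ⊗ ω_{W₂,V}(g₂,h)x₂) = ω_{W,V}((g₁,g₂),h) e(x₁ ⊗ x₂)` — i.e.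
`ω_{W,V}|_{G(W₁)×G(W₂)×H(V)} ≅ ω_{W₁,V} ⊠ ω_{W₂,V}` restricted to the diagonal `H(V)` (`seesaw_tmul`,
`seesawRestriction`).

NOT here: the groups and spaces themselves, theta kernels / theta series (adelic), the choice of characters
(`χ_W = χ_{W₁}χ_{W₂}` is the content of `HSideCompatible` via `beta_sum`), anything about a particular dual pair.

## References

* [GanTakeda2015] Gan–Takeda, JAMS 29 (2016), §2.8.
* [HarrisKudlaSweet1996] HKS, JAMS 9 (1996), §1 (1.12)–(1.19), Cor. A.3 p. 998.
* [MoeglinVignerasWaldspurger1987] MVW, LNM 1291, Chap. 2 II.1 Rem. (6).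
* [Kudla1994] S. Kudla, Israel J. Math. 87 (1994).
-/

namespace Literature.RepresentationTheory.HarrisKudlaSweet1996

open scoped TensorProduct
open Literature.RepresentationTheory.MoeglinVignerasWaldspurger1987

/-- **Carriers for the seesaw `W = W₁ ⊕ W₂` paired with `V`** ([GanTakeda2015, §2.8]; [HarrisKudlaSweet1996, §1]):
parameter types `G₁ = G(W₁)`, `G₂ = G(W₂)`, `G = G(W)`, `H = H(V)` (points over a local field, or adelic points),
`M₁, M₂, M = Mp(𝕎₁), Mp(𝕎₂), Mp(𝕎)` (`𝕎 = Res_{E/F}(W ⊗ V)` etc.) and the spaces `S₁, S₂, S` of the three `ω_ψ`;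
fields: the inclusion `G(W₁) × G(W₂) ⊂ G(W)`, Kudla's homomorphism `j̃`, the three Weil representations `ω_ψ` of
the metaplectic groups, the `G`-side splittings `ι̃_{V,χ_V}` of `G(W)`, `G(W₁)`, `G(W₂)` and the `H`-side splittings
`ι̃_{W,χ_W}`, `ι̃_{W₁,χ₁}`, `ι̃_{W₂,χ₂}` of `H(V)` into `Mp(𝕎)`, `Mp(𝕎₁)`, `Mp(𝕎₂)`.  A hypothesis structure:
nothing is asserted. [cite: GanTakeda2015, §2.8] -/
structure UnitarySeesawCover (G₁ G₂ G H : Type*) (M₁ M₂ M : Type*) (S₁ S₂ S : Type*) [Group M₁] [Group M₂]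
    [Group M] [AddCommGroup S₁] [Module ℂ S₁] [AddCommGroup S₂] [Module ℂ S₂] [AddCommGroup S] [Module ℂ S] where
  /-- `G(W₁) × G(W₂) ⊂ G(W)` -/
  incl : G₁ → G₂ → G
  /-- Kudla's `j̃ : Mp(𝕎₁) × Mp(𝕎₂) ⟶ Mp(𝕎)`, a homomorphism -/
  jt : M₁ × M₂ →* M
  /-- `ω_ψ` of `Mp(𝕎)` -/
  Ω : M → (S →ₗ[ℂ] S)
  /-- `ω_ψ^1` of `Mp(𝕎₁)` -/
  Ω₁ : M₁ → (S₁ →ₗ[ℂ] S₁)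
  /-- `ω_ψ^2` of `Mp(𝕎₂)` -/
  Ω₂ : M₂ → (S₂ →ₗ[ℂ] S₂)
  /-- `ι̃_{V,χ_V} : G(W) ⟶ Mp(𝕎)` -/
  ιW : G → M
  /-- `ι̃_{V,χ_V} : G(W₁) ⟶ Mp(𝕎₁)` -/
  ιW₁ : G₁ → M₁
  /-- `ι̃_{V,χ_V} : G(W₂) ⟶ Mp(𝕎₂)` -/
  ιW₂ : G₂ → M₂
  /-- `ι̃_{W,χ_W} : H(V) ⟶ Mp(𝕎)` -/
  ιV : H → M
  /-- `ι̃_{W₁,χ₁} : H(V) ⟶ Mp(𝕎₁)` -/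
  ιV₁ : H → M₁
  /-- `ι̃_{W₂,χ₂} : H(V) ⟶ Mp(𝕎₂)` -/
  ιV₂ : H → M₂

namespace UnitarySeesawCover

variable {G₁ G₂ G H M₁ M₂ M S₁ S₂ S : Type*} [Group M₁] [Group M₂] [Group M] [AddCommGroup S₁] [Module ℂ S₁]
  [AddCommGroup S₂] [Module ℂ S₂] [AddCommGroup S] [Module ℂ S]

/-- The underlying metaplectic sum datum (carriers of [MoeglinVignerasWaldspurger1987, Chap. 2 II.1 Rem. (6)]).
[cite: MoeglinVignerasWaldspurger1987, Chap. 2 II.1 Rem. (6)] -/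
def toMetaplecticSumDatum (C : UnitarySeesawCover G₁ G₂ G H M₁ M₂ M S₁ S₂ S) :
    MetaplecticSumDatum M₁ M₂ M S₁ S₂ S where
  jt m₁ m₂ := C.jt (m₁, m₂)
  ω := C.Ω
  ω₁ := C.Ω₁
  ω₂ := C.Ω₂

/-- The underlying restriction datum of the `G`-side splittings (carriers of [HarrisKudlaSweet1996, Cor. A.3]).
[cite: HarrisKudlaSweet1996, Cor. A.3 p. 998] -/
def toHKSRestrictionDatum (C : UnitarySeesawCover G₁ G₂ G H M₁ M₂ M S₁ S₂ S) :
    HKSRestrictionDatum G G₁ G₂ M M₁ M₂ where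
  incl := C.incl
  jt m₁ m₂ := C.jt (m₁, m₂)
  ι := C.ιW
  ι₁ := C.ιW₁
  ι₂ := C.ιW₂

/-- **The Weil representation `ω_{W,V,χ,ψ}` of `G(W) × H(V)` restricted to `G(W₁) × G(W₂) × H(V)`, DEFINED as the
pullback** [GanTakeda2015, §2.8]: "Pulling back the Weil representation of `Mp(W ⊗ V)` to `G(W) × H(V)` via the
splitting, we obtain the associated Weil representation `ω_{W,V,χ,ψ}` of `G(W) × H(V)`":
`ω((g₁,g₂),h) := ω_ψ(ι̃_{V,χ_V}(g₁,g₂) · ι̃_{W,χ_W}(h))`. [cite: GanTakeda2015, §2.8] -/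
def omega (C : UnitarySeesawCover G₁ G₂ G H M₁ M₂ M S₁ S₂ S) (g₁ : G₁) (g₂ : G₂) (h : H) :
    S →ₗ[ℂ] S :=
  C.Ω (C.ιW (C.incl g₁ g₂) * C.ιV h)

/-- `ω_{W₁,V,χ,ψ}(g₁,h) := ω_ψ^1(ι̃_{V,χ_V}(g₁) · ι̃_{W₁,χ₁}(h))` (pullback, [GanTakeda2015, §2.8]).
[cite: GanTakeda2015, §2.8] -/
def omega₁ (C : UnitarySeesawCover G₁ G₂ G H M₁ M₂ M S₁ S₂ S) (g₁ : G₁) (h : H) : S₁ →ₗ[ℂ] S₁ :=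
  C.Ω₁ (C.ιW₁ g₁ * C.ιV₁ h)

/-- `ω_{W₂,V,χ,ψ}(g₂,h) := ω_ψ^2(ι̃_{V,χ_V}(g₂) · ι̃_{W₂,χ₂}(h))` (pullback, [GanTakeda2015, §2.8]).
[cite: GanTakeda2015, §2.8] -/
def omega₂ (C : UnitarySeesawCover G₁ G₂ G H M₁ M₂ M S₁ S₂ S) (g₂ : G₂) (h : H) : S₂ →ₗ[ℂ] S₂ :=
  C.Ω₂ (C.ιW₂ g₂ * C.ιV₂ h)

/-- **`H`-side compatibility of the splittings with `j̃`** (the partner-side counterpart of [HarrisKudlaSweet1996,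
Cor. A.3]): `j̃(ι̃_{W₁,χ₁}(h), ι̃_{W₂,χ₂}(h)) = ι̃_{W,χ_W}(h)` for `h ∈ H(V)`.  In the coordinates `Mp ≃ Sp × ℂ¹` of
(1.12) the `ℂ¹`-components are `β_{W₁,χ₁}(h)`, `β_{W₂,χ₂}(h)`, `β_{W,χ_W}(h)`, whose product rule for
`χ_W = χ₁χ₂` is `HKSSplittingDatum.beta_sum`, and `j̃` reads `((σ₁,z₁),(σ₂,z₂)) ↦ (diag(σ₁,σ₂), z₁z₂)` by Ranga
Rao's Prop. 3.7 (`RaoDirectSumDatum.StandardModelTensor.tensorAutHom_opOf`).  A hypothesis predicate: nothing is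
asserted. [folklore] -/
def HSideCompatible (C : UnitarySeesawCover G₁ G₂ G H M₁ M₂ M S₁ S₂ S) : Prop :=
  ∀ h : H, C.jt (C.ιV₁ h, C.ιV₂ h) = C.ιV h

/-- Compatibility of all splittings with `j̃` ON ELEMENTS of `G(W₁) × G(W₂) × H(V)`:
`j̃(ι̃_{V}(g₁) ι̃_{W₁}(h), ι̃_{V}(g₂) ι̃_{W₂}(h)) = ι̃_{V}(g₁,g₂) ι̃_{W}(h)`.  A hypothesis predicate: nothing is
asserted (it is DERIVED in `splittingsCompatible_of`). [folklore] -/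
def SplittingsCompatible (C : UnitarySeesawCover G₁ G₂ G H M₁ M₂ M S₁ S₂ S) : Prop :=
  ∀ (g₁ : G₁) (g₂ : G₂) (h : H), C.jt (C.ιW₁ g₁ * C.ιV₁ h, C.ιW₂ g₂ * C.ιV₂ h) = C.ιW (C.incl g₁ g₂) * C.ιV h

variable {C : UnitarySeesawCover G₁ G₂ G H M₁ M₂ M S₁ S₂ S}

/-- **[HarrisKudlaSweet1996, Cor. A.3] for the `G`-side + the `H`-side compatibility ⇒ compatibility on
`G(W₁) × G(W₂) × H(V)`** (`j̃` is a homomorphism). [folklore] -/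
theorem splittingsCompatible_of (hA3 : C.toHKSRestrictionDatum.SplittingRestricts) (hH : C.HSideCompatible) :
    C.SplittingsCompatible := by
  intro g₁ g₂ h
  have hmul : C.jt (C.ιW₁ g₁ * C.ιV₁ h, C.ιW₂ g₂ * C.ιV₂ h) =
      C.jt (C.ιW₁ g₁, C.ιW₂ g₂) * C.jt (C.ιV₁ h, C.ιV₂ h) := by
    rw [← map_mul, Prod.mk_mul_mk]
  have hW : C.jt (C.ιW₁ g₁, C.ιW₂ g₂) = C.ιW (C.incl g₁ g₂) := (hA3 g₁ g₂).symm
  rw [hmul, hW, hH h]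

/-- **The seesaw restriction on pure tensors:** if `ω_ψ ∘ j̃ ≃ ω_ψ^1 ⊠ ω_ψ^2` via `e` ([MoeglinVignerasWaldspurger1987,
Rem. (6)], in the shape of `MetaplecticSumDatum.WeilRepMultiplicative`) and the splittings are compatible, then
`e (ω_{W₁,V}(g₁,h)x₁ ⊗ ω_{W₂,V}(g₂,h)x₂) = ω_{W,V}((g₁,g₂),h) (e (x₁ ⊗ x₂))` — the restriction of `ω_{W,V,χ,ψ}` to
`G(W₁) × G(W₂) × H(V)^Δ` is `ω_{W₁,V} ⊠ ω_{W₂,V}`. [folklore] -/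
theorem seesaw_tmul (hcompat : C.SplittingsCompatible) (e : S₁ ⊗[ℂ] S₂ ≃ₗ[ℂ] S)
    (hKu : ∀ (m₁ : M₁) (m₂ : M₂) (x₁ : S₁) (x₂ : S₂),
      e (C.Ω₁ m₁ x₁ ⊗ₜ[ℂ] C.Ω₂ m₂ x₂) = C.Ω (C.jt (m₁, m₂)) (e (x₁ ⊗ₜ[ℂ] x₂)))
    (g₁ : G₁) (g₂ : G₂) (h : H) (x₁ : S₁) (x₂ : S₂) :
    e (C.omega₁ g₁ h x₁ ⊗ₜ[ℂ] C.omega₂ g₂ h x₂) = C.omega g₁ g₂ h (e (x₁ ⊗ₜ[ℂ] x₂)) := by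
  rw [omega₁, omega₂, hKu, hcompat, omega]

/-- The hypothesis `hKu` of `seesaw_tmul` IS `WeilRepMultiplicative` of the underlying metaplectic sum datum with
witness `e` (link between the two records). [folklore] -/
theorem weilRepMultiplicative_of (e : S₁ ⊗[ℂ] S₂ ≃ₗ[ℂ] S)
    (hKu : ∀ (m₁ : M₁) (m₂ : M₂) (x₁ : S₁) (x₂ : S₂),
      e (C.Ω₁ m₁ x₁ ⊗ₜ[ℂ] C.Ω₂ m₂ x₂) = C.Ω (C.jt (m₁, m₂)) (e (x₁ ⊗ₜ[ℂ] x₂))) :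
    C.toMetaplecticSumDatum.WeilRepMultiplicative :=
  ⟨e, hKu⟩

/-- **The seesaw restriction `ω_{W,V}|_{G(W₁)×G(W₂)×H(V)^Δ} ≅ ω_{W₁,V} ⊠ ω_{W₂,V}` from the three printed
ingredients:** MVW Rem. (6) for the metaplectic datum (`WeilRepMultiplicative`), HKS Cor. A.3 for the `G`-side
splittings and the `H`-side compatibility. [folklore] -/
theorem seesawRestriction (hMVW : C.toMetaplecticSumDatum.WeilRepMultiplicative)
    (hA3 : C.toHKSRestrictionDatum.SplittingRestricts) (hH : C.HSideCompatible) :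
    ∃ e : S₁ ⊗[ℂ] S₂ ≃ₗ[ℂ] S, ∀ (g₁ : G₁) (g₂ : G₂) (h : H) (x₁ : S₁) (x₂ : S₂),
      e (C.omega₁ g₁ h x₁ ⊗ₜ[ℂ] C.omega₂ g₂ h x₂) = C.omega g₁ g₂ h (e (x₁ ⊗ₜ[ℂ] x₂)) := by
  obtain ⟨e, he⟩ := hMVW
  exact ⟨e, seesaw_tmul (splittingsCompatible_of hA3 hH) e he⟩

end UnitarySeesawCover

end Literature.RepresentationTheory.HarrisKudlaSweet1996
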